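import Mathlib.Data.Finset.Interval
import Summits.QuantumAdvantage.QuantumAdvantage.Theorems.CubicForrelationNearExactIsExactBentDuality
import Summits.QuantumAdvantage.QuantumAdvantage.Theorems.CubicForrelationNearExactIsExactRmWeight

/-!
# Crux `CubicForrelation.NearExactIsExact` (stmt-QuantumAdvantage-14043) — Rothaus' degree bound for bent functions

Line `direct-sum-amplification`, OPEN stub `stub_bentSidedBand` (bent branch), registered helper stub
`bb_rothaus_isDegLeFun`. In the tree's `Bool` / `IsDegLeFun` / `W` vocabulary:

* `bb_rothaus_isDegLeFun` (**Rothaus 1976**; Carlet 2021, Thm 13; MacWilliams–Sloane Ch. 14 §5): a bent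
  function `g` on `n = m + m ≥ 4` bits (`W_g(x)² = 2ⁿ` for all `x`, `W_g(x) = Σ_y (-1)^{g(y)} (-1)^{y·x}`) has
  algebraic degree `≤ m`. (False for `m = 1`: `x₀x₁` is bent of degree `2`.)
* `bb_moebius_isDegLeFun` (binary Möbius inversion, the infrastructure lemma): if for every coordinate set `I`
  with `|I| > d` the number of `x` supported in `I` with `f x = 1` is even, then `deg f ≤ d` — the ANF coefficient
  of the monomial `X^I` is that parity.
* `bb_poisson` (Poisson summation on a coordinate subspace): `Σ_{u ∈ E_J} W_G(u) = 2^{|J|} Σ_{x ∈ E_{Jᶜ}} G(x)`,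
  where `E_J = {u : supp u ⊆ J}` is the coordinate cube, written `{u : Fin n → Bool | ∀ i, u i = true → i ∈ J}`
  throughout (a `Finset` filter of `univ`; supports are `{i | x i = true}`; no definitions are introduced).
* Corollaries for the bent branch: the dual of a bent function is bent (`bb_W_dual`, `bb_dual_isBent`: in fact
  `W_{g̃} = 2^m (-1)^g`) and has degree `≤ m` (`bb_dual_isDegLeFun`); every Boolean function on `n` bits has degree
  `≤ n` (`bb_isDegLeFun_card`); and the band `Φ(f,g) = 1 ∨ Φ(f,g) ≤ 31/32` for cubic `f` and bent `g` on
  `m + m ≤ 12` bits GIVEN ONLY the Reed–Muller minimum-weight statement (`bb_band_small_m_of_rm`, hypothesis = the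
  statement of the landed `stub_rmWeight`) or only the derivative-degree statement (`bb_band_small_m_of_derivDegree`,
  hypothesis = the statement of the landed `stub_derivDegree`, through `stub_rmWeight`) — no Hou-type hypothesis:
  `deg g̃ ≤ m ≤ 6` by Rothaus applied to the (bent) dual, so `f ⊕ g̃` has degree `≤ 6`.

Proof of Rothaus' bound (the parity argument of Carlet 2021 Thm 13 / MacWilliams–Sloane Ch. 14). Fix `I` with
`|I| = k > m` and let `J = Iᶜ`, `|J| = j = 2m − k < m`. POISSON: `Σ_{u ∈ E_J} W_g(u) = 2^j Σ_{x ∈ E_I} (-1)^{g(x)}`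
(sum the characters `u ↦ (-1)^{x·u}` over the product set `E_J`: coordinatewise, `Π_{l ∈ J} (1 + (-1)^{x_l})`).
With the dual `d` (`W_g = 2^m (-1)^d`, `bb_exists_dual`) and `Σ_{E} (-1)^h = |E| − 2·#{h = 1 on E}` this reads
`2^m (2^j − 2B) = 2^j (2^k − 2A)` with `A = #{x ∈ E_I : g x = 1}`, `B = #{u ∈ E_J : d u = 1}`; cancelling `2^{j+1}`
gives `2^{m−j−1} (2^j − 2B) = 2^{k−1} − A`, i.e. `A = 2 (2^{k−2} − 2^{m−2} + 2^{m−j−1} B)` (`bb_even_of_balance`; this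
is where `m ≥ 2` and `k ≥ m + 1` enter), so `A` is even for every `|I| > m`, and Möbius inversion
(`bb_moebius_isDegLeFun` with `d = m`) gives `deg g ≤ m`. MÖBIUS: with `a_I = Σ_{y ∈ E_I} [f y] ∈ 𝔽₂` and
`p = Σ_I a_I X^I` (total degree `≤ d` since `a_I = 0` for `|I| > d`),
`p(x) = Σ_{I ⊆ supp x} a_I = Σ_{y ≼ x} [f y] · #{I : supp y ⊆ I ⊆ supp x} = Σ_{y ≼ x} [f y] 2^{|supp x ∖ supp y|} = [f x]`
in `𝔽₂` (`Finset.card_Icc_finset`).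

Sources: O. S. Rothaus, On "bent" functions, J. Combin. Theory Ser. A 20 (1976) 300–305; C. Carlet, Boolean Functions
for Cryptography and Coding Theory, CUP 2021, §2.2 (ANF, binary Möbius transform), Thm 13 (degree of bent functions),
§6.1 (duals); F. J. MacWilliams, N. J. A. Sloane, The Theory of Error-Correcting Codes (1977), Ch. 13 §2 (ANF) and
Ch. 14 §5 (bent functions). Everything below is proved from Mathlib and the tree; axioms are the standard three.
Imports: the landed bent-duality lemmas (`bb_exists_dual`, `bb_band_of_dual_degree`), the landed `stub_rmWeight`, and
`Mathlib.Data.Finset.Interval`; the Theses file is deliberately NOT imported.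
-/

set_option linter.dupNamespace false -- D-0017: single-problem summit

noncomputable section

namespace Summit.QuantumAdvantage.QuantumAdvantage.Theorems.CubicForrelation.NearExactIsExact

open Finset
open Literature.Computability.QuantumComplexity
open Literature.Computability.QuantumComplexity.BuzetChailloux (bxor zeroVec signOf_sq)
open Literature.Computability.QuantumComplexity.DerivativeWalsh (W)

variable {n : ℕ}

/-! ### Coordinate cubes `{u | ∀ i, u i = true → i ∈ I}` and supports `{i | x i = true}` -/

/-- The coordinate cube `E_I = {u : supp u ⊆ I}` is a product set: coordinate `l` ranges over `{0,1}` if `l ∈ I` and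
over `{0}` otherwise. -/
theorem bb_cube_eq_pi (I : Finset (Fin n)) :
    ({u : Fin n → Bool | ∀ i, u i = true → i ∈ I} : Finset (Fin n → Bool)) =
      Fintype.piFinset fun l => if l ∈ I then (univ : Finset Bool) else {false} := by
  ext u
  rw [mem_filter, Fintype.mem_piFinset]
  simp only [mem_univ, true_and]
  refine forall_congr' fun l => ?_
  by_cases hl : l ∈ I <;> simp [hl]

/-- `|E_I| = 2^{|I|}`. -/
theorem bb_card_cube (I : Finset (Fin n)) : #{u : Fin n → Bool | ∀ i, u i = true → i ∈ I} = 2 ^ #I := by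
  rw [bb_cube_eq_pi, Fintype.card_piFinset]
  have h : ∀ l : Fin n, #(if l ∈ I then (univ : Finset Bool) else {false}) = if l ∈ I then 2 else 1 := by
    intro l
    split_ifs <;> simp
  simp_rw [h]
  rw [prod_ite_mem, univ_inter, prod_const]

/-- Membership in the cube of `I` is `supp u ⊆ I`. -/
theorem bb_mem_cube_iff {I : Finset (Fin n)} {u : Fin n → Bool} :
    u ∈ ({u : Fin n → Bool | ∀ i, u i = true → i ∈ I} : Finset (Fin n → Bool)) ↔
      ({i | u i = true} : Finset (Fin n)) ⊆ I := by
  simp [subset_iff]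

/-- `x` lies in the cube of its own support. -/
theorem bb_mem_cube_supp (x : Fin n → Bool) :
    x ∈ ({u : Fin n → Bool | ∀ i, u i = true → i ∈ ({i | x i = true} : Finset (Fin n))} :
      Finset (Fin n → Bool)) := by
  simp

/-- A Boolean vector is determined by its support. -/
theorem bb_eq_of_supp_eq {x y : Fin n → Bool}
    (h : ({i | x i = true} : Finset (Fin n)) = ({i | y i = true} : Finset (Fin n))) : x = y := by
  funext i
  have hi := Finset.ext_iff.1 h i
  simp only [mem_filter, mem_univ, true_and] at hi
  cases hx : x i <;> cases hy : y i <;> simp_all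

/-! ### Binary Möbius inversion: parities of cube counts are ANF coefficients -/

/-- **Möbius inversion on the Boolean lattice, in `𝔽₂`.** For any `c : {0,1}ⁿ → 𝔽₂` and any `x`:
`Σ_{I ⊆ supp x} Σ_{y ∈ E_I} c(y) = c(x)` — each `y ≼ x` is counted `#{I : supp y ⊆ I ⊆ supp x} = 2^{|supp x| − |supp y|}`
times, which is even unless `y = x`. (Carlet 2021 §2.2, binary Möbius transform.) -/
theorem bb_moebius_sum (c : (Fin n → Bool) → ZMod 2) (x : Fin n → Bool) :
    ∑ I ∈ ({i | x i = true} : Finset (Fin n)).powerset,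
      ∑ y ∈ {u : Fin n → Bool | ∀ i, u i = true → i ∈ I}, c y = c x := by
  rw [sum_comm' (t' := {u : Fin n → Bool | ∀ i, u i = true → i ∈ ({i | x i = true} : Finset (Fin n))})
    (s' := fun y => ({i | x i = true} : Finset (Fin n)).powerset.filter fun I =>
      ({i | y i = true} : Finset (Fin n)) ⊆ I)]
  · refine (sum_congr rfl fun y _ => sum_const (c y)).trans ?_
    rw [sum_eq_single_of_mem x (bb_mem_cube_supp x)]
    · rw [← Icc_eq_filter_powerset, card_Icc_finset Subset.rfl, Nat.sub_self, pow_zero, one_smul]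
    · intro y hy hyx
      have hsub : ({i | y i = true} : Finset (Fin n)) ⊆ ({i | x i = true} : Finset (Fin n)) :=
        bb_mem_cube_iff.1 hy
      rw [← Icc_eq_filter_powerset, card_Icc_finset hsub, nsmul_eq_mul]
      have hlt : #({i | y i = true} : Finset (Fin n)) < #({i | x i = true} : Finset (Fin n)) :=
        card_lt_card (Finset.ssubset_iff_subset_ne.2 ⟨hsub, fun h => hyx (bb_eq_of_supp_eq h)⟩)
      obtain ⟨e, he⟩ : ∃ e, #({i | x i = true} : Finset (Fin n)) - #({i | y i = true} : Finset (Fin n)) = e + 1 :=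
        ⟨#({i | x i = true} : Finset (Fin n)) - #({i | y i = true} : Finset (Fin n)) - 1, by omega⟩
      have h2 : (2 : ZMod 2) = 0 := by decide
      rw [he, Nat.cast_pow, Nat.cast_ofNat, h2, zero_pow (Nat.succ_ne_zero e), zero_mul]
  · intro I y
    rw [mem_powerset, bb_mem_cube_iff, mem_filter, mem_powerset, bb_mem_cube_iff]
    exact ⟨fun h => ⟨⟨h.1, h.2⟩, h.2.trans h.1⟩, fun h => h.1⟩

/-- If `a_I = 0` whenever `|I| > d`, the polynomial `Σ_I a_I X^I` has total degree `≤ d`. -/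
theorem bb_totalDegree_poly {a : Finset (Fin n) → ZMod 2} {d : ℕ} (ha : ∀ I, d < #I → a I = 0) :
    (∑ I : Finset (Fin n), MvPolynomial.C (a I) * ∏ i ∈ I, MvPolynomial.X i :
      MvPolynomial (Fin n) (ZMod 2)).totalDegree ≤ d := by
  refine (MvPolynomial.totalDegree_finsetSum _ _).trans (Finset.sup_le fun I _ => ?_)
  by_cases hI : d < #I
  · rw [ha I hI, MvPolynomial.C_0, zero_mul, MvPolynomial.totalDegree_zero]
    exact Nat.zero_le _
  · push Not at hI
    refine (MvPolynomial.totalDegree_mul _ _).trans ?_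
    rw [MvPolynomial.totalDegree_C, zero_add]
    refine (MvPolynomial.totalDegree_finsetProd _ _).trans (le_trans ?_ hI)
    rw [card_eq_sum_ones I]
    exact sum_le_sum fun i _ => (MvPolynomial.totalDegree_X (R := ZMod 2) i).le

/-- Values of `Σ_I a_I X^I` at a `0/1` point: `p(x) = Σ_{I ⊆ supp x} a_I`. -/
theorem bb_eval_poly (a : Finset (Fin n) → ZMod 2) (x : Fin n → Bool) :
    MvPolynomial.eval (fun j => if x j then (1 : ZMod 2) else 0)
        (∑ I : Finset (Fin n), MvPolynomial.C (a I) * ∏ i ∈ I, MvPolynomial.X i) =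
      ∑ I ∈ ({i | x i = true} : Finset (Fin n)).powerset, a I := by
  rw [map_sum]
  simp_rw [map_mul, MvPolynomial.eval_C, map_prod, MvPolynomial.eval_X, prod_boole, mul_boole]
  have hc : ∀ I : Finset (Fin n), (∀ i ∈ I, x i = true) ↔ I ∈ ({i | x i = true} : Finset (Fin n)).powerset :=
    fun I => by simp [subset_iff]
  rw [← univ_inter ({i | x i = true} : Finset (Fin n)).powerset, ← sum_ite_mem]
  refine sum_congr rfl fun I _ => ?_
  by_cases h : I ∈ ({i | x i = true} : Finset (Fin n)).powerset
  · rw [if_pos h, if_pos ((hc I).2 h)]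
  · rw [if_neg h, if_neg (mt (hc I).1 h)]

/-- **Möbius inversion ⇒ degree bound** (the infrastructure lemma). If for every coordinate set `I` with `|I| > d`
the number of `u` supported inside `I` (`∀ i, u i = 1 → i ∈ I`) with `f u = 1` is even, then `f` has algebraic
degree `≤ d`: the ANF of `f` is `Σ_I a_I X^I` with `a_I =` that parity (Carlet 2021 §2.2; MacWilliams–Sloane
Ch. 13 §2). -/
theorem bb_moebius_isDegLeFun (d : ℕ) (f : (Fin n → Bool) → Bool)
    (h : ∀ I : Finset (Fin n), d < #I → Even #{u : Fin n → Bool | (∀ i, u i = true → i ∈ I) ∧ f u = true}) :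
    IsDegLeFun d f := by
  refine ⟨∑ I : Finset (Fin n), MvPolynomial.C (∑ y ∈ {u : Fin n → Bool | ∀ i, u i = true → i ∈ I},
      (if f y then 1 else 0 : ZMod 2)) * ∏ i ∈ I, MvPolynomial.X i,
    bb_totalDegree_poly fun I hI => ?_, fun x => ?_⟩
  · rw [sum_boole, filter_filter, ZMod.natCast_eq_zero_iff_even]
    exact h I hI
  · rw [polyPhase_apply, bb_eval_poly, bb_moebius_sum (fun y => if f y then 1 else 0) x]
    cases f x <;> decide

/-- Every Boolean function on `n` bits has algebraic degree `≤ n` (no coordinate set has more than `n` elements). -/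
theorem bb_isDegLeFun_card (f : (Fin n → Bool) → Bool) : IsDegLeFun n f :=
  bb_moebius_isDegLeFun n f fun I hI =>
    absurd ((card_le_univ I).trans_eq (Fintype.card_fin n)) (not_le.2 hI)

/-! ### Poisson summation over a coordinate cube -/

/-- Character sums over a cube: `Σ_{u ∈ E_J} (-1)^{x·u} = 2^{|J|}` if `x` vanishes on `J`, and `0` otherwise
(the sum factors coordinatewise: `Π_{l ∈ J} (1 + (-1)^{x_l})`). -/
theorem bb_sum_twist_cube (J : Finset (Fin n)) (x : Fin n → Bool) :
    ∑ u ∈ {u : Fin n → Bool | ∀ i, u i = true → i ∈ J}, twist x u =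
      if (∀ l ∈ J, x l = false) then (2 : ℝ) ^ #J else 0 := by
  have key : ∑ u ∈ {u : Fin n → Bool | ∀ i, u i = true → i ∈ J}, twist x u =
      ∏ l, ∑ b ∈ (if l ∈ J then (univ : Finset Bool) else {false}), (if x l && b then (-1 : ℝ) else 1) := by
    rw [bb_cube_eq_pi]
    unfold twist
    exact (prod_univ_sum (fun l => if l ∈ J then (univ : Finset Bool) else {false})
      (fun l b => if x l && b then (-1 : ℝ) else 1)).symm
  have step : ∀ l : Fin n, (∑ b ∈ (if l ∈ J then (univ : Finset Bool) else {false}),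
      (if x l && b then (-1 : ℝ) else 1)) = if l ∈ J then (if x l then 0 else 2) else 1 := by
    intro l
    split_ifs with hl hx
    · simp [hx]
    · simp [hx]
    · simp
  rw [key, prod_congr rfl fun l _ => step l, prod_ite_mem, univ_inter]
  split_ifs with hJ
  · rw [prod_congr rfl fun l hl => by rw [hJ l hl], prod_const]
    simp
  · push Not at hJ
    obtain ⟨l, hl, hxl⟩ := hJ
    refine prod_eq_zero hl ?_
    cases hx : x l
    · exact absurd hx hxl
    · simp

/-- **Poisson summation on a coordinate subspace.** For any real `G` on `{0,1}ⁿ` and any coordinate set `J`: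
`Σ_{u ∈ E_J} W_G(u) = 2^{|J|} Σ_{x ∈ E_{Jᶜ}} G(x)` (`W_G(u) = Σ_x G(x) (-1)^{x·u}`; `E_J^⊥ = E_{Jᶜ}`).
(MacWilliams–Sloane Ch. 14; Carlet 2021, proof of Thm 13.) -/
theorem bb_poisson (G : (Fin n → Bool) → ℝ) (J : Finset (Fin n)) :
    ∑ u ∈ {u : Fin n → Bool | ∀ i, u i = true → i ∈ J}, W G u =
      (2 : ℝ) ^ #J * ∑ x ∈ {u : Fin n → Bool | ∀ i, u i = true → i ∈ Jᶜ}, G x := by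
  unfold W
  rw [sum_comm]
  simp_rw [← mul_sum, bb_sum_twist_cube, mul_ite, mul_zero]
  rw [← sum_filter, mul_sum]
  refine sum_congr ?_ fun x _ => mul_comm _ _
  ext x
  simp only [mem_filter, mem_univ, true_and, mem_compl]
  constructor
  · intro h i hi hiJ
    rw [h i hiJ] at hi
    exact Bool.false_ne_true hi
  · intro h l hl
    cases hx : x l
    · rfl
    · exact absurd hl (h l hx)

/-- `Σ_{y : p y} (-1)^{h(y)} = #{p} − 2·#{y : p y ∧ h y = 1}`. -/
theorem bb_sum_signOf (p : (Fin n → Bool) → Prop) [DecidablePred p] (h : (Fin n → Bool) → Bool) :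
    ∑ y ∈ univ.filter p, signOf (h y) = (#(univ.filter p) : ℝ) - 2 * #(univ.filter fun y => p y ∧ h y = true) := by
  have e : ∀ y, signOf (h y) = 1 - 2 * (if h y = true then (1 : ℝ) else 0) := fun y => by
    unfold signOf
    split_ifs <;> norm_num
  rw [sum_congr rfl fun y _ => e y, sum_sub_distrib, sum_const, nsmul_eq_mul, mul_one, ← mul_sum, sum_boole,
    filter_filter]

/-- The arithmetic of the evenness step: if `2 ≤ m < k`, `j + k = 2m` and
`2^m (2^j − 2B) = 2^j (2^k − 2A)` in `ℤ`, then `A` is even (`A = 2(2^{k−2} − 2^{m−2} + 2^{m−j−1} B)`). -/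
theorem bb_even_of_balance {m j k A B : ℕ} (hm : 2 ≤ m) (hk : m < k) (hjk : j + k = m + m)
    (h : (2 : ℤ) ^ m * (2 ^ j - 2 * B) = 2 ^ j * (2 ^ k - 2 * A)) : Even A := by
  have e1 : (2 : ℤ) ^ m = 2 ^ j * 2 * 2 ^ (m - j - 1) := by
    rw [← pow_succ, ← pow_add]; congr 1; omega
  have e2 : (2 : ℤ) ^ k = 2 * (2 * 2 ^ (k - 2)) := by
    rw [← pow_succ', ← pow_succ']; congr 1; omega
  have e3 : (2 : ℤ) ^ (m - j - 1) * 2 ^ j = 2 * 2 ^ (m - 2) := by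
    rw [← pow_add, ← pow_succ']; congr 1; omega
  have h0 : (2 : ℤ) ^ j * 2 ≠ 0 := by positivity
  have h1 : (2 : ℤ) ^ (m - j - 1) * (2 ^ j - 2 * B) = 2 * 2 ^ (k - 2) - A := by
    apply mul_left_cancel₀ h0
    rw [← mul_assoc, ← e1, h, e2]; ring
  have hA : (A : ℤ) = 2 * (2 ^ (k - 2) - 2 ^ (m - 2) + 2 ^ (m - j - 1) * B) := by
    linear_combination h1 - e3
  have h2 : (2 : ℤ) ∣ (A : ℤ) := ⟨_, hA⟩
  exact even_iff_two_dvd.2 (by exact_mod_cast h2)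

/-! ### Rothaus' bound -/

/-- **Rothaus' bound** (Rothaus 1976; Carlet 2021 Thm 13; MacWilliams–Sloane Ch. 14 §5): a bent function on
`n = m + m ≥ 4` bits — `W_g(x)² = 2ⁿ` for every `x` — has algebraic degree at most `m = n/2`. Proof: for every
coordinate set `I` with `|I| > m`, Poisson summation over `E_{Iᶜ}` against the dual (`W_g = 2^m (-1)^{g̃}`) shows that
`#{x ∈ E_I : g x = 1}` is even (`bb_even_of_balance`); conclude by Möbius inversion (`bb_moebius_isDegLeFun`). -/
theorem bb_rothaus_isDegLeFun :
    ∀ (m : ℕ) (g : (Fin (m + m) → Bool) → Bool), 2 ≤ m →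
      (∀ x, W (fun y => signOf (g y)) x ^ 2 = (2 : ℝ) ^ (m + m)) → IsDegLeFun m g := by
  intro m g hm hbent
  obtain ⟨d, hd⟩ := bb_exists_dual hbent
  refine bb_moebius_isDegLeFun m g fun I hI => ?_
  have hP : ∑ u ∈ {u : Fin (m + m) → Bool | ∀ i, u i = true → i ∈ Iᶜ}, W (fun y => signOf (g y)) u =
      (2 : ℝ) ^ #Iᶜ * ∑ x ∈ {u : Fin (m + m) → Bool | ∀ i, u i = true → i ∈ I}, signOf (g x) := by
    have h := bb_poisson (fun y => signOf (g y)) Iᶜ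
    rwa [compl_compl] at h
  rw [sum_congr rfl fun u _ => hd u, ← mul_sum, bb_sum_signOf, bb_sum_signOf, bb_card_cube,
    bb_card_cube] at hP
  push_cast at hP
  set A := #{u : Fin (m + m) → Bool | (∀ i, u i = true → i ∈ I) ∧ g u = true}
  set B := #{u : Fin (m + m) → Bool | (∀ i, u i = true → i ∈ Iᶜ) ∧ d u = true}
  have hk : #I ≤ m + m := (card_le_univ I).trans_eq (Fintype.card_fin (m + m))
  have hj : #Iᶜ + #I = m + m := by
    rw [card_compl, Fintype.card_fin]; omega
  refine bb_even_of_balance (B := B) hm hI hj ?_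
  have h' : (((2 : ℤ) ^ m * (2 ^ #Iᶜ - 2 * (B : ℤ)) : ℤ) : ℝ) =
      (((2 : ℤ) ^ #Iᶜ * (2 ^ #I - 2 * (A : ℤ)) : ℤ) : ℝ) := by
    push_cast
    linear_combination hP
  exact_mod_cast h'

/-! ### Corollaries for the bent branch -/

variable {m : ℕ}

/-- **The Walsh transform of the dual.** If `W_g = 2^m (-1)^{d}` (so `g` is bent with dual `d = g̃`), then
`W_d = 2^m (-1)^{g}`: Walsh inversion `Σ_u W_g(u) (-1)^{u·x} = 2ⁿ (-1)^{g(x)}`. (Rothaus 1976; Carlet 2021 §6.1: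
the dual of a bent function is bent and its dual is `g`.) -/
theorem bb_W_dual {g d : (Fin (m + m) → Bool) → Bool}
    (hd : ∀ x, W (fun y => signOf (g y)) x = (2 : ℝ) ^ m * signOf (d x)) (x : Fin (m + m) → Bool) :
    W (fun y => signOf (d y)) x = (2 : ℝ) ^ m * signOf (g x) := by
  have h2m : (2 : ℝ) ^ m ≠ 0 := by positivity
  apply mul_left_cancel₀ h2m
  calc (2 : ℝ) ^ m * W (fun y => signOf (d y)) x
      = ∑ u, W (fun y => signOf (g y)) u * twist u x := by
        rw [W, mul_sum]
        refine sum_congr rfl fun u _ => ?_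
        rw [hd u]
        ring
    _ = ∑ y, signOf (g y) * ∑ u, twist (bxor y x) u := by
        unfold W
        simp_rw [sum_mul, mul_sum]
        rw [sum_comm]
        refine sum_congr rfl fun y _ => sum_congr rfl fun u _ => ?_
        rw [DerivativeWalsh.twist_bxor_left, twist_comm u x]
        ring
    _ = (2 : ℝ) ^ (m + m) * signOf (g x) := by
        rw [sum_eq_single x (fun y _ hyx => ?_) (fun h => absurd (mem_univ x) h)]
        · have hz : (bxor x x = fun _ => false) := BuzetChailloux.bxor_self x
          rw [Simon.sum_twist, if_pos hz, mul_comm]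
        · have hz : ¬ (bxor y x = fun _ => false) := fun h =>
            hyx ((BuzetChailloux.bxor_eq_zeroVec_iff y x).1 h)
          rw [Simon.sum_twist, if_neg hz, mul_zero]
    _ = (2 : ℝ) ^ m * ((2 : ℝ) ^ m * signOf (g x)) := by
        rw [pow_add]
        ring

/-- **The dual of a bent function is bent**, in the stub's form: `W_g = 2^m (-1)^d ⇒ W_d(x)² = 2^{m+m}` for all `x`. -/
theorem bb_dual_isBent {g d : (Fin (m + m) → Bool) → Bool}
    (hd : ∀ x, W (fun y => signOf (g y)) x = (2 : ℝ) ^ m * signOf (d x)) :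
    ∀ x, W (fun y => signOf (d y)) x ^ 2 = (2 : ℝ) ^ (m + m) := fun x => by
  rw [bb_W_dual hd x, mul_pow, signOf_sq, mul_one, ← pow_mul, mul_two]

/-- **The dual of a bent function on `m + m ≥ 4` bits has degree `≤ m`** (Rothaus applied to the bent dual). -/
theorem bb_dual_isDegLeFun {g d : (Fin (m + m) → Bool) → Bool} (hm : 2 ≤ m)
    (hd : ∀ x, W (fun y => signOf (g y)) x = (2 : ℝ) ^ m * signOf (d x)) : IsDegLeFun m d :=
  bb_rothaus_isDegLeFun m d hm (bb_dual_isBent hd)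

/-- **The bent band in small dimension, given only the Reed–Muller minimum weight.** Conditional on the RM
minimum-weight statement `hR` (the statement of the landed `stub_rmWeight`, itself proved from the statement of the
landed `stub_derivDegree`): for `m ≤ 6` (`n ≤ 12`), every `f` of degree `≤ 3` (indeed `≤ 6`) and every bent `g` on
`m + m` bits satisfy `Φ(f,g) = 1 ∨ Φ(f,g) ≤ 31/32` — the dual `g̃` has degree `≤ 6` (Rothaus for `m ≥ 2`; for
`m ≤ 1` every function on `m + m ≤ 2` bits has degree `≤ 2`), so the word `f ⊕ g̃` has degree `≤ 6` and
`Φ = 1 − 2·wt(f ⊕ g̃)/2ⁿ` (`bb_band_of_dual_degree` with `d₀ = 6`). No Hou-type hypothesis on cubic bent functions is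
needed. -/
theorem bb_band_small_m_of_rm
    (hR : ∀ (m d : ℕ) (e : (Fin m → Bool) → Bool), IsDegLeFun d e → (∃ x, e x = true) →
      2 ^ m ≤ 2 ^ d * (univ.filter fun x => e x = true).card)
    (m : ℕ) (hm6 : m ≤ 6) (f g : (Fin (m + m) → Bool) → Bool) (hf : IsDegLeFun 3 f)
    (hbent : ∀ x, W (fun y => signOf (g y)) x ^ 2 = (2 : ℝ) ^ (m + m)) :
    forrelation f g = 1 ∨ forrelation f g ≤ 31 / 32 := by
  obtain ⟨d, hd⟩ := bb_exists_dual hbent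
  have hdd : IsDegLeFun 6 d := by
    by_cases hm : 2 ≤ m
    · exact (bb_dual_isDegLeFun hm hd).mono hm6
    · exact (bb_isDegLeFun_card d).mono (by omega)
  rcases bb_band_of_dual_degree hR m 6 f g d (hf.mono (by norm_num)) hdd hd with h | h
  · exact Or.inl h
  · right
    norm_num at h
    exact h

/-- **The bent band in small dimension, given only the derivative-degree statement** `hD` (the statement of the
landed `stub_derivDegree`: a derivative `x ↦ e(x) ⊕ e(x ⊕ t)` lowers the degree by one), through the landed
`stub_rmWeight`: for `m ≤ 6`, cubic `f` and bent `g` on `m + m` bits, `Φ(f,g) = 1 ∨ Φ(f,g) ≤ 31/32`. With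
`hD := stub_derivDegree` this is the unconditional small-`n` bent band (no Hou hypothesis). -/
theorem bb_band_small_m_of_derivDegree
    (hD : ∀ (n d : ℕ) (e : (Fin n → Bool) → Bool) (t : Fin n → Bool), IsDegLeFun (d + 1) e →
      IsDegLeFun d (fun x => e x ^^ e (bxor x t)))
    (m : ℕ) (hm6 : m ≤ 6) (f g : (Fin (m + m) → Bool) → Bool) (hf : IsDegLeFun 3 f)
    (hbent : ∀ x, W (fun y => signOf (g y)) x ^ 2 = (2 : ℝ) ^ (m + m)) :
    forrelation f g = 1 ∨ forrelation f g ≤ 31 / 32 :=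
  bb_band_small_m_of_rm (stub_rmWeight hD) m hm6 f g hf hbent

end Summit.QuantumAdvantage.QuantumAdvantage.Theorems.CubicForrelation.NearExactIsExact
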